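import Mathlib
import Literature.NumberTheory.Automorphic.HilbertModularFormQExpansion
import Summits.Langlands.Langlands.Theorems.CapacityClassicalityHilbertIntegralOverconvergentIsCongruenceHilbertClassicality
import Summits.Langlands.Langlands.Theorems.CapacityClassicalityHilbertIntegralOverconvergentIsCongruenceHilbertClassicalitySturmReduction

/-!
# Hilbert classicality modulo the named facts — the variant with named fact (i) in its CLASSICAL form
# (Sturm mod 𝔭 + bounded denominators) (line `Sketch-ideate-r1-k1`, § T, crux stmt-Langlands-8485)

`hilbertClassicalityModuloNamedFacts_modP`: the end-to-end assembly `hilbertClassicalityModuloNamedFacts` with its hypothesis `hSt`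
(the `p`-adic SUP-NORM Sturm bound) replaced by the pair the literature states — `hmodp`, STURM MOD 𝔭 for `v`-integral `E`-rational
Hilbert modular forms of level `Γ₁(𝔫)` on the trace window `{Tr(αν) < L b}` (window length `L` affine in `∑_σ |b_σ|`, `hL`), and
`hbdd`, BOUNDED DENOMINATORS of `E`-rational forms — through `hcm_sturmSupNorm_of_modP` (discreteness of `‖v(E^×)‖`).  All other
hypotheses and the conclusion are those of `hilbertClassicalityModuloNamedFacts`.
-/

set_option linter.dupNamespace false

noncomputable section

namespace Summit.Langlands.Langlands.Theorems.HilbertIntegralOverconvergentIsCongruence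

open MeasureTheory Complex NumberField
open Literature.NumberTheory.Automorphic Literature.NumberTheory.Automorphic.HilbertModular
open scoped MatrixGroups NumberField

/-- **Hilbert classicality modulo the named facts, with (i) = Sturm mod 𝔭 + bounded denominators.**  See the module docstring and
`hilbertClassicalityModuloNamedFacts`. [folklore] -/
theorem hilbertClassicalityModuloNamedFacts_modP (F : Type) [Field F] [NumberField F] [NumberField.IsTotallyReal F]
    (hd : 1 < Module.finrank ℚ F) (𝔫 : Ideal (𝓞 F)) (h𝔫 : 𝔫 ≠ ⊥)
    (E : Type) [Field E] [NumberField E] (τ : E →+* ℂ) (p : ℕ) [Fact p.Prime] (v : E →+* PadicAlgCl p)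
    (d : ℕ) (idx : F → (Fin d →₀ ℕ)) (α : F) (enc : (Point F → ℂ) → MvPowerSeries (Fin d) ℂ)
    (hd1 : 1 ≤ d) (hα : ∀ σ : F →+* ℝ, 0 < σ α) (hinj : Set.InjOn idx (qIndexSet F))
    (hadd : ∀ μ ∈ qIndexSet F, ∀ μ' ∈ qIndexSet F, idx (μ + μ') = idx μ + idx μ')
    (htrace : ∀ ν ∈ qIndexSet F, ((∑ j, idx ν j : ℕ) : ℚ) = Algebra.trace ℚ F (α * ν))
    (henc : ∀ f : Point F → ℂ, (∀ μ ∈ qIndexSet F, MvPowerSeries.coeff (idx μ) (enc f) = fourierCoeff f μ) ∧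
      ∀ n, (∀ μ ∈ qIndexSet F, idx μ ≠ n) → MvPowerSeries.coeff n (enc f) = 0)
    (L : ((F →+* ℝ) → ℤ) → ℕ) (cS : ℝ) (hL : ∀ b, (L b : ℝ) ≤ cS * (∑ σ, |(b σ : ℝ)| + 1))
    (hmodp : ∀ (b : (F →+* ℝ) → ℤ) (f : Point F → ℂ), f ∈ modularForms (Bianchi.Gamma1 𝔫) b →
      ∀ q : F → E, (∀ ν ∈ qIndexSet F, fourierCoeff f ν = τ (q ν)) → (∀ ν ∈ qIndexSet F, ‖v (q ν)‖ ≤ 1) →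
      (∀ ν ∈ qIndexSet F, ((Algebra.trace ℚ F (α * ν) : ℚ) : ℝ) < L b → ‖v (q ν)‖ < 1) →
      ∀ ν ∈ qIndexSet F, ‖v (q ν)‖ < 1)
    (hbdd : ∀ (b : (F →+* ℝ) → ℤ) (f : Point F → ℂ), f ∈ modularForms (Bianchi.Gamma1 𝔫) b →
      ∀ q : F → E, (∀ ν ∈ qIndexSet F, fourierCoeff f ν = τ (q ν)) → ∃ C : ℝ, ∀ ν ∈ qIndexSet F, ‖v (q ν)‖ ≤ C)
    (k : (F →+* ℝ) → ℤ)
    (hSup : ∃ (w₀ : (F →+* ℝ) → ℤ) (gf : Fin (d + 1) → Point F → ℂ) (qg : Fin (d + 1) → F → E) (G : Point F → ℂ)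
      (qG : F → E),
      (∀ l, gf l ∈ modularForms (Bianchi.Gamma1 𝔫) w₀) ∧ G ∈ modularForms (Bianchi.Gamma1 𝔫) (w₀ - k) ∧
      (∃ z ∈ halfSpace F, G z ≠ 0) ∧
      (∀ l, ∀ ν ∈ qIndexSet F, fourierCoeff (gf l) ν = τ (qg l ν)) ∧ (∀ ν ∈ qIndexSet F, fourierCoeff G ν = τ (qG ν)) ∧
      (∀ l ν, IsIntegral ℤ (qg l ν)) ∧ (∀ ν, IsIntegral ℤ (qG ν)) ∧
      (∀ l (τ' : E →+* ℂ) (y : (F →+* ℝ) → ℝ), (∀ σ, 0 < y σ) →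
        Summable (fun ν : {ν : F | ∀ b : 𝓞 F, ∃ n : ℤ, Algebra.trace ℚ F (ν * b) = n} ↦
          ‖τ' (qg l ν)‖ * Real.exp (-(2 * Real.pi * ∑ σ : F →+* ℝ, σ (ν : F) * y σ)))) ∧
      (∀ (τ' : E →+* ℂ) (y : (F →+* ℝ) → ℝ), (∀ σ, 0 < y σ) →
        Summable (fun ν : {ν : F | ∀ b : 𝓞 F, ∃ n : ℤ, Algebra.trace ℚ F (ν * b) = n} ↦
          ‖τ' (qG ν)‖ * Real.exp (-(2 * Real.pi * ∑ σ : F →+* ℝ, σ (ν : F) * y σ)))) ∧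
      ∀ (m : ℕ) (κ : Sym (Fin (d + 1)) m → ℂ),
        (∀ z ∈ halfSpace F, ∑ s, κ s * ((s : Multiset (Fin (d + 1))).map (fun l ↦ gf l z)).prod = 0) → ∀ s, κ s = 0)
    (c : F → E) (hc_int : ∀ ν, IsIntegral ℤ (c ν)) (hc_supp : ∀ ν ∉ qIndexSet F, c ν = 0)
    (harch_c : ∀ (τ' : E →+* ℂ) (y : (F →+* ℝ) → ℝ), (∀ σ, 0 < y σ) →
      Summable (fun ν : {ν : F | ∀ b : 𝓞 F, ∃ n : ℤ, Algebra.trace ℚ F (ν * b) = n} ↦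
        ‖τ' (c ν)‖ * Real.exp (-(2 * Real.pi * ∑ σ : F →+* ℝ, σ (ν : F) * y σ))))
    (hKatz : ∃ (t : (F →+* ℝ) → ℤ) (e : MvPowerSeries (Fin d) (PadicAlgCl p)) (a : ℕ → MvPowerSeries (Fin d) (PadicAlgCl p))
      (ρ C : ℝ), t ≠ 0 ∧
      e ∈ Submodule.span (PadicAlgCl p)
        {ψ | ∃ (A : MvPowerSeries (Fin d) E) (f : Point F → ℂ), f ∈ modularForms (Bianchi.Gamma1 𝔫) t ∧
          MvPowerSeries.map τ A = enc f ∧ ψ = MvPowerSeries.map v A} ∧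
      MvPowerSeries.constantCoeff e = 1 ∧ (∀ n, ‖MvPowerSeries.coeff n e‖ ≤ 1) ∧
      (∀ i : ℕ, a i ∈ Submodule.span (PadicAlgCl p)
        {ψ | ∃ (A : MvPowerSeries (Fin d) E) (f : Point F → ℂ), f ∈ modularForms (Bianchi.Gamma1 𝔫) (k + i • t) ∧
          MvPowerSeries.map τ A = enc f ∧ ψ = MvPowerSeries.map v A}) ∧
      0 < ρ ∧ ρ < 1 ∧ 0 ≤ C ∧ (∀ i n, ‖MvPowerSeries.coeff n (a i)‖ ≤ C * ρ ^ i) ∧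
      (∀ ν ∈ qIndexSet F, HasSum (fun i : ℕ ↦ MvPowerSeries.coeff (idx ν) (a i * e⁻¹ ^ i)) (v (c ν))) ∧
      ∀ n, (∀ ν ∈ qIndexSet F, idx ν ≠ n) → HasSum (fun i : ℕ ↦ MvPowerSeries.coeff n (a i * e⁻¹ ^ i)) 0) :
    (∃ 𝔪 : Ideal (𝓞 F), 𝔪 ≠ ⊥ ∧
      (halfSpace F).indicator (fun z ↦
        ∑' ν : {ν : F | ∀ b : 𝓞 F, ∃ n : ℤ, Algebra.trace ℚ F (ν * b) = n},
          τ (c ν) * cexp (2 * Real.pi * I * pairing (ν : F) z)) ∈ modularForms (Bianchi.Gamma1 𝔪) k) ∧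
    ∀ ν : F, (∀ b : 𝓞 F, ∃ n : ℤ, Algebra.trace ℚ F (ν * b) = n) → ∀ y : (F →+* ℝ) → ℝ, (∀ σ, 0 < y σ) →
      fourierCoeffAt ((halfSpace F).indicator (fun z ↦
        ∑' ν : {ν : F | ∀ b : 𝓞 F, ∃ n : ℤ, Algebra.trace ℚ F (ν * b) = n},
          τ (c ν) * cexp (2 * Real.pi * I * pairing (ν : F) z))) ν y = τ (c ν) := by
  refine hilbertClassicalityModuloNamedFacts F hd 𝔫 h𝔫 E τ p v d idx α enc hd1 hα hinj hadd htrace henc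
    ⟨L, cS, hL, fun b f hf q hq B hB hwin ↦ ?_⟩ k hSup c hc_int hc_supp harch_c hKatz
  exact hcm_sturmSupNorm_of_modP F 𝔫 α E τ p v L hmodp hbdd b f hf q hq B hB hwin

end Summit.Langlands.Langlands.Theorems.HilbertIntegralOverconvergentIsCongruence

end
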